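import Literature.AlgebraicGeometry.Hu2025.Proofs.S03Pluecker.Prop36
import Mathlib.Data.Finsupp.Weight
import HarnessLib

/-!
# Hu 2025 §3.3 — DISCHARGE of `C18L15` («𝕀^lt_{3,n} ⟷ 𝓕_m, u ↦ F_{m,u} … Obviously, this is a bijection», chunk p0018 l.11–15): the map
# `u ↦ F̄_{m,u}` is injective on `𝕀^lt_{3,n}` over a nontrivial base ring (row 101b, typer res-type-009)

**HONEST FRAMING (D-0012/D-0089).** A theorem about OUR typed transcription; the preprint [Hu2025] stays «under review». Proof: the coefficient of the
LINEAR monomial `x_t` in `F̄_{m,u}` is `1` if `t = u` and `0` otherwise (all other terms are products of two variables), so `F̄_{m,u}` determines `u`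
when `1 ≠ 0`. AI proof, weaker than expert review; nothing here is progress on resolution of singularities.
-/

noncomputable section

namespace Literature.AlgebraicGeometry.Hu2025.Statements.S03Pluecker

open MvPolynomial

universe u

variable {n : ℕ} (k : Type u) [CommRing k]

/-- A product of two chart look-ups `x̄_s · x̄_{s'}` with `s, s' ≠ m` has no linear term.
[cite: Hu2025, Def. 3.4 «Obviously, this is a bijection» (C18L15), p.37 l.26–29 (unrefereed preprint arXiv:2507.21400v1 under adjudication, D-0012/D-0089
— kernel support on OUR typed carriers of row 101; nothing of the source asserted)] -/
theorem coeff_single_xbar_mul {s s' : ℕ × ℕ × ℕ} (hs : s ≠ mTri) (hs' : s' ≠ mTri) (x : plVar n) :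
    coeff (Finsupp.single x 1) (xbar k s * xbar k s' : ChartRing n k) = 0 := by
  classical
  unfold xbar
  rw [if_neg hs, if_neg hs']
  split_ifs with h h'
  · rw [X, X, monomial_mul, coeff_monomial, if_neg]
    intro heq
    have hd := DFunLike.congr_arg (Finsupp.degree : (plVar n →₀ ℕ) →+ ℕ) heq
    rw [map_add, Finsupp.degree_single, Finsupp.degree_single, Finsupp.degree_single] at hd
    omega
  · rw [mul_zero, coeff_zero]
  · rw [zero_mul, coeff_zero]
  · rw [mul_zero, coeff_zero]

/-- The linear coefficient of `x̄_s`, `s ∈ 𝕀_{3,n} ∖ m`: `1` at `x_s`, `0` elsewhere.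
[cite: Hu2025, Def. 3.4 «Obviously, this is a bijection» (C18L15), p.37 l.26–29 (unrefereed preprint arXiv:2507.21400v1 under adjudication, D-0012/D-0089
— kernel support on OUR typed carriers of row 101; nothing of the source asserted)] -/
theorem coeff_single_xbar {s : ℕ × ℕ × ℕ} (hs : s ∈ plVarSet n) (x : plVar n) :
    coeff (Finsupp.single x 1) (xbar k s : ChartRing n k) = if x.1 = s then 1 else 0 := by
  classical
  rw [xbar_of_mem k hs, coeff_X]
  by_cases hx : x.1 = s
  · have : x = ⟨s, hs⟩ := Subtype.ext hx
    subst this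
    rw [if_pos rfl, if_pos rfl]
  · rw [if_neg hx, if_neg]
    intro h
    exact hx (congrArg Subtype.val (Finsupp.single_left_injective one_ne_zero h)).symm

/-- **The linear part of `F̄_{m,u'}` is `x_{u'}`**: for `u' ∈ 𝕀^lt_{3,n}` and any chart variable `x_t`, the coefficient of `x_t` in `F̄_{m,u'}` is
`1` if `t = u'` and `0` otherwise.
[cite: Hu2025, Def. 3.4 «Obviously, this is a bijection» (C18L15), p.37 l.26–29 (unrefereed preprint arXiv:2507.21400v1 under adjudication, D-0012/D-0089
— kernel support on OUR typed carriers of row 101; nothing of the source asserted)] -/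
theorem coeff_single_primaryRelBar {u' : ℕ × ℕ × ℕ} (hu' : u' ∈ plIndexSet n) (hlt : IsLt u') (x : plVar n) :
    coeff (Finsupp.single x 1) (primaryRelBar n k u') = if x.1 = u' then 1 else 0 := by
  classical
  have h3 := three_lt_of_isLt (n := n) hu' hlt
  have hu'' := hu'
  obtain ⟨u₁, u₂, u₃⟩ := u'
  rw [mem_plIndexSet_iff] at hu''
  simp only at hu'' h3
  obtain ⟨⟨h1a, h1b⟩, ⟨⟨h2a, h2b⟩, ⟨h3a, h3b⟩⟩, h12, h23⟩ := hu''
  have hm : (u₁, u₂, u₃) ∈ plVarSet n := mem_plVarSet h1a h12 h23 h3b (by omega)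
  -- every index triple occurring in the quadratic terms differs from `m = (1,2,3)` (one of its entries exceeds `3`)
  have N : ∀ a b c : ℕ, 3 < c → ((a, b, c) : ℕ × ℕ × ℕ) ≠ mTri := by
    intro a b c hc h; unfold mTri at h; simp only [Prod.mk.injEq] at h; omega
  have N' : ∀ a b c : ℕ, 3 < b → ((a, b, c) : ℕ × ℕ × ℕ) ≠ mTri := by
    intro a b c hb h; unfold mTri at h; simp only [Prod.mk.injEq] at h; omega
  have hu3 : 3 < u₃ := lt_trans h3 h23
  rw [primaryRelBar_eq k _ hlt, xbar_mTri]
  simp only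
  by_cases e1 : u₁ = 1
  · rw [if_pos e1, mul_one, coeff_add, coeff_sub, coeff_single_xbar k hm, coeff_single_xbar_mul k (N _ _ _ h3) (N _ _ _ hu3),
      coeff_single_xbar_mul k (N _ _ _ h3) (N _ _ _ hu3), sub_zero, add_zero]
  by_cases e2 : u₁ = 2
  · rw [if_neg e1, if_pos e2, mul_one, coeff_add, coeff_sub, coeff_single_xbar k hm, coeff_single_xbar_mul k (N _ _ _ h3) (N _ _ _ hu3),
      coeff_single_xbar_mul k (N _ _ _ h3) (N _ _ _ hu3), sub_zero, add_zero]
  by_cases e3 : u₁ = 3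
  · rw [if_neg e1, if_neg e2, if_pos e3, mul_one, coeff_add, coeff_sub, coeff_single_xbar k hm,
      coeff_single_xbar_mul k (N _ _ _ h3) (N _ _ _ hu3), coeff_single_xbar_mul k (N _ _ _ h3) (N _ _ _ hu3), sub_zero, add_zero]
  · have h4 : 3 < u₁ := by omega
    rw [if_neg e1, if_neg e2, if_neg e3, mul_one, coeff_sub, coeff_add, coeff_sub, coeff_single_xbar k hm,
      coeff_single_xbar_mul k (N _ _ _ h4) (N' _ _ _ h3), coeff_single_xbar_mul k (N _ _ _ h4) (N' _ _ _ h3),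
      coeff_single_xbar_mul k (N _ _ _ h4) (N' _ _ _ h3), sub_zero, add_zero, sub_zero]

/-- **`C18L15` HOLDS** as typed: `u ↦ F̄_{m,u}` is injective on `𝕀^lt_{3,n}` (nontrivial `k`).
[cite: Hu2025, Def. 3.4 «Obviously, this is a bijection» (C18L15), p.37 l.26–29 (unrefereed preprint arXiv:2507.21400v1 under adjudication, D-0012/D-0089
— kernel support on OUR typed carriers of row 101; nothing of the source asserted)] -/
theorem C18L15_holds : C18L15 n k := by
  intro hk u hu v hv huv
  simp only [Set.mem_setOf_eq] at hu hv
  have h3 := three_lt_of_isLt (n := n) u.2 hu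
  have hb := mem_plIndexSet_iff.mp u.2
  have hm : u.1 ∈ plVarSet n := by
    obtain ⟨⟨u₁, u₂, u₃⟩, hu1⟩ := u
    simp only at hb h3 ⊢
    exact mem_plVarSet hb.1.1 hb.2.2.1 hb.2.2.2 hb.2.1.2.2 (by omega)
  have hc := congrArg (coeff (Finsupp.single (⟨u.1, hm⟩ : plVar n) 1)) huv
  simp only at hc
  rw [coeff_single_primaryRelBar k u.2 hu, coeff_single_primaryRelBar k v.2 hv, if_pos rfl] at hc
  split_ifs at hc with h
  · exact Subtype.ext h
  · exact absurd hc one_ne_zero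

end Literature.AlgebraicGeometry.Hu2025.Statements.S03Pluecker

end
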